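import Summits.QuantumFields.YangMills.Theorems.BalabanUVNodesN21GappedTopPairReading13CoPHFaces
import Summits.QuantumFields.YangMills.Theorems.BalabanUVNodesN21GappedCollarDesignIJunctionPair

/-!
# N21 (NE7c) · END-TO-END AT dag-n21-w7's DOUBLY-GAPPED PAIR READING `crGap2₁₃VAt N K₀ jcut ρ ρ′ n₁ n₂`: N21's DECL shape `ShellWeightBound` WITH BOTH DIAL PAIRS PRODUCED from TWO
# relative two-run closeness letters — `δ` for the (3.2) family (units of `ε`), `δ′′` for the (3.3) family (units of `2δ_k`) — together with both collar-compatibility blocks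

Track A of `YM-PLAN.md` (cell `pub-ymgap`), node **N21** (NE7c, NOT PRINTED); WIDTH SEAT `pub-ymgap-dag-n21-w2` (gen 3), file 10.  THEOREMS ONLY: 0 `def`, 0 `sorry`; COUNT-NEUTRAL;
`--kind proof --supports stmt-QuantumFields-27366 --as helper` (K3⁸).  Imports dag-n21-w7's `…GappedTopPairReading13CoPHFaces` (`shellWeightBound_crGap2₁₃VAt`,
`keyedShellWeight_shape_crGap2₁₃V_of_rows`) and this seat's file 7 `…GappedCollarDesignIJunctionPair` (→ file 2 `exists_widthDepthLetters_of_summable`, file 3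
`collar_rows_at_selGapDepth_A∕B`, file 7 `bCollar_rows_of_dials`).  No Theses import; restates nothing.

WHY.  The (3.2)-family twin is this seat's file 6 (`…GappedReadingShellFaceOfCloseness`, p629355 ✓) on dag-n21-d's `crGap₁₃VAt`.  dag-n21-w7's pair reading re-letters BOTH indicator
families of the last 𝐓-step and reads TWO dial pairs `(ρ, n₁)`, `(ρ′, n₂)` under the rows `0 ≤ ρ, ρ′ ≤ 1`, `Σ_K (1/(n₁+1) + 1/(n₂+1)) < ∞`; the consumer's junction (files 7, 8) needs the
same letters to clear the (3.2)-scale closeness `Δ = ε·δ` and the (3.3)-scale closeness `Δ′ = (2δ_k)·δ′′` at the selected collars.  THIS FILE produces both pairs from the two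
closeness letters by TWO applications of file 2 and plugs them into dag-n21-w7's face BY NAME; the tops' sign rows `0 ≤ ε`, `0 ≤ δ_k` and the live-selector pin ∕ (H-ζ) stay rows.

WHAT IS PROVED ([bookkeeping] BY NAME).
* ★★★ `exists_letters_shellWeightBound_crGap2₁₃VAt_of_closeness` — from `δ, δ′′ : WidthLetter₁₃CoPH N` with `0 ≤ · ≤ 1/16`, `Σ_K · < ∞` at every tuple: `∃ ρ ρ′ n₁ n₂` such that (i) at every
  tuple on the live line under (H-ζ) and the sign rows, dag-n21-w7's `ShellWeightBound` at `crGap2₁₃VAt N K₀ jcut ρ ρ′ n₁ n₂`; (ii) the (3.2) compatibility block for `(ρ, n₁)` w.r.t. `δ`;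
  (iii) the (3.3) compatibility block for `(ρ′, n₂)` w.r.t. `δ′′`.
* ★ `summable_inv_add_inv` — the bookkeeping step `Σ 1/(n₁+1) < ∞ ∧ Σ 1/(n₂+1) < ∞ ⇒ Σ (1/(n₁+1) + 1/(n₂+1)) < ∞`.

HONEST FRAMING.  Both closeness letters are HYPOTHESES (N16's two-run closeness at the (2.17) and (3.3) scales; NOT PRINTED), inhabited for no family here; nothing of Bałaban's
asserted; NE7c at print's fixed thresholds NOT PRINTED ∕ NOT proved; **N21 NOT discharged**; K3⁷∕K3⁸ NOT claimed (no pin names `crGap2₁₃V` today); counts UNMOVED (typed 28∕28 ·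
discharged 5∕27); never a count claim.  One finite four-torus programme at fixed `ε` — NOT ℝ⁴, NOT OS, NOT a mass gap, NOT the Clay problem.  No decl below carries a cite tag.
-/

namespace Summit.QuantumFields.YangMills.Theorems.N21GappedPairReadingShellFaceOfCloseness

open Literature.MathematicalPhysics.QuantumFieldTheory.Balaban1983to89
open Literature.MathematicalPhysics.QuantumFieldTheory.Balaban1983to89.T4Continuum
open Literature.MathematicalPhysics.QuantumFieldTheory.Balaban1983to89.Node00
open T4IndicatorShell (ShellWeightBound)
open YMDAG.UVSplit (histA₁₃ histB₁₃)
open Summit.QuantumFields.YangMills.Theorems.N21ShellSplitOfRecord13CoPH (WidthLetter₁₃CoPH DepthLetter₁₃CoPH)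
open Summit.QuantumFields.YangMills.Theorems.N21GappedTopPair13CoPH (crGap2₁₃VAt shellWeightBound_crGap2₁₃VAt)
open Summit.QuantumFields.YangMills.Theorems.N21GappedTopCutDials (exists_widthDepthLetters_of_summable)

variable {N : ℕ} [NeZero N]

/-- Two summable dial series add up (dag-n21-w7's pair face reads the SUM `Σ_K (1/(n₁ K+1) + 1/(n₂ K+1))`). [bookkeeping] -/
theorem summable_inv_add_inv {n₁ n₂ : ℕ → ℕ} (h₁ : Summable (fun K => 1 / ((n₁ K : ℝ) + 1))) (h₂ : Summable (fun K => 1 / ((n₂ K : ℝ) + 1))) :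
    Summable (fun K => 1 / ((n₁ K : ℝ) + 1) + 1 / ((n₂ K : ℝ) + 1)) :=
  h₁.add h₂

/-- ★★★ **N21's SHELL FACE AT THE DOUBLY-GAPPED PAIR READING WITH BOTH DIAL PAIRS PRODUCED FROM TWO CLOSENESS LETTERS.**  For closeness letters `δ` ((3.2) family) and `δ′′` ((3.3)
family) with `0 ≤ · ≤ 1/16` and `Σ_K · < ∞` at every tuple: there are letters `ρ, ρ′, n₁, n₂` such that (i) at every tuple on the live-selector line, under (H-ζ) and the sign rows
`0 ≤ ε` (tops) ∕ `0 ≤ δ_k` (old levels), `T4IndicatorShell.ShellWeightBound` holds at dag-n21-w7's `crGap2₁₃VAt N K₀ jcut ρ ρ′ n₁ n₂` (their `shellWeightBound_crGap2₁₃VAt` BY NAME,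
(M1)-free), and (ii)∕(iii) the two compatibility blocks hold at every tuple. [bookkeeping] -/
theorem exists_letters_shellWeightBound_crGap2₁₃VAt_of_closeness (K₀ : ℕ) (jcut : ℕ → ℕ) (δ δ'' : WidthLetter₁₃CoPH N)
    (h0 : ∀ (F : T4Family) (θ : Stage13HParams F N) (hP : θ.Provisos₁₃CoPH F N) (g₀ : ℕ → ℝ) (os : List (ULoop F)) (K : ℕ), 0 ≤ δ F θ hP g₀ os K)
    (h16 : ∀ (F : T4Family) (θ : Stage13HParams F N) (hP : θ.Provisos₁₃CoPH F N) (g₀ : ℕ → ℝ) (os : List (ULoop F)) (K : ℕ), δ F θ hP g₀ os K ≤ 1 / 16)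
    (hs : ∀ (F : T4Family) (θ : Stage13HParams F N) (hP : θ.Provisos₁₃CoPH F N) (g₀ : ℕ → ℝ) (os : List (ULoop F)), Summable (δ F θ hP g₀ os))
    (h0' : ∀ (F : T4Family) (θ : Stage13HParams F N) (hP : θ.Provisos₁₃CoPH F N) (g₀ : ℕ → ℝ) (os : List (ULoop F)) (K : ℕ), 0 ≤ δ'' F θ hP g₀ os K)
    (h16' : ∀ (F : T4Family) (θ : Stage13HParams F N) (hP : θ.Provisos₁₃CoPH F N) (g₀ : ℕ → ℝ) (os : List (ULoop F)) (K : ℕ), δ'' F θ hP g₀ os K ≤ 1 / 16)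
    (hs' : ∀ (F : T4Family) (θ : Stage13HParams F N) (hP : θ.Provisos₁₃CoPH F N) (g₀ : ℕ → ℝ) (os : List (ULoop F)), Summable (δ'' F θ hP g₀ os)) :
    ∃ (ρ ρ' : WidthLetter₁₃CoPH N) (n₁ n₂ : DepthLetter₁₃CoPH N),
      (∀ (F : T4Family) (θ : Stage13HParams F N) (hP : θ.Provisos₁₃CoPH F N) (g₀ : ℕ → ℝ) (os : List (ULoop F)) (E : B12.RunParams → ℝ),
        θ.ppSel = ppSelLiveOfRecord F N θ.ν θ.τ9 E (wOfRecord₉ F N θ.toStage9Params) → ZetaMeasurable F N θ.ζ →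
        (∀ K, 0 ≤ epsOfRecord θ.ν (histA₁₃ θ K₀ g₀ K) (K₀ + K)) → (∀ K, 0 ≤ epsOfRecord θ.ν (histB₁₃ θ K₀ g₀ K) (K₀ + K + 1)) →
        (∀ K, 0 ≤ deltaOfRecord θ.ν (histA₁₃ θ K₀ g₀ K) (K₀ + K - 1) θ.A₁) → (∀ K, 0 ≤ deltaOfRecord θ.ν (histB₁₃ θ K₀ g₀ K) (K₀ + K) θ.A₁) →
        ShellWeightBound (crGap2₁₃VAt N K₀ jcut ρ ρ' n₁ n₂ F θ hP g₀ os).l₀ (crGap2₁₃VAt N K₀ jcut ρ ρ' n₁ n₂ F θ hP g₀ os).T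
          (crGap2₁₃VAt N K₀ jcut ρ ρ' n₁ n₂ F θ hP g₀ os).A (crGap2₁₃VAt N K₀ jcut ρ ρ' n₁ n₂ F θ hP g₀ os).B (crGap2₁₃VAt N K₀ jcut ρ ρ' n₁ n₂ F θ hP g₀ os).shA
          (crGap2₁₃VAt N K₀ jcut ρ ρ' n₁ n₂ F θ hP g₀ os).shB (crGap2₁₃VAt N K₀ jcut ρ ρ' n₁ n₂ F θ hP g₀ os).Wsh) ∧
      (∀ (F : T4Family) (θ : Stage13HParams F N) (hP : θ.Provisos₁₃CoPH F N) (g₀ : ℕ → ℝ) (os : List (ULoop F)),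
        (∀ K, 0 ≤ ρ F θ hP g₀ os K) ∧ (∀ K, ρ F θ hP g₀ os K ≤ 1) ∧ Summable (fun K => 1 / ((n₁ F θ hP g₀ os K : ℝ) + 1)) ∧
        (∀ K, 2 * δ F θ hP g₀ os K ≤ ρ F θ hP g₀ os K) ∧ (∀ K, (1 : ℝ) / 2 ≤ (1 - ρ F θ hP g₀ os K) ^ (n₁ F θ hP g₀ os K + 2)) ∧
        (∀ K i, i ≤ n₁ F θ hP g₀ os K + 2 → δ F θ hP g₀ os K ≤ (1 - ρ F θ hP g₀ os K) ^ i * ρ F θ hP g₀ os K)) ∧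
      (∀ (F : T4Family) (θ : Stage13HParams F N) (hP : θ.Provisos₁₃CoPH F N) (g₀ : ℕ → ℝ) (os : List (ULoop F)),
        (∀ K, 0 ≤ ρ' F θ hP g₀ os K) ∧ (∀ K, ρ' F θ hP g₀ os K ≤ 1) ∧ Summable (fun K => 1 / ((n₂ F θ hP g₀ os K : ℝ) + 1)) ∧
        (∀ K, 2 * δ'' F θ hP g₀ os K ≤ ρ' F θ hP g₀ os K) ∧ (∀ K, (1 : ℝ) / 2 ≤ (1 - ρ' F θ hP g₀ os K) ^ (n₂ F θ hP g₀ os K + 2)) ∧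
        (∀ K i, i ≤ n₂ F θ hP g₀ os K + 2 → δ'' F θ hP g₀ os K ≤ (1 - ρ' F θ hP g₀ os K) ^ i * ρ' F θ hP g₀ os K)) := by
  obtain ⟨ρ, n₁, h⟩ := exists_widthDepthLetters_of_summable δ h0 h16 hs
  obtain ⟨ρ', n₂, h'⟩ := exists_widthDepthLetters_of_summable δ'' h0' h16' hs'
  refine ⟨ρ, ρ', n₁, n₂, fun F θ hP g₀ os E hsel hζm hεA hεB hδA hδB => ?_, h, h'⟩
  obtain ⟨hρ0, hρ1, hn, -, -, -⟩ := h F θ hP g₀ os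
  obtain ⟨hρ'0, hρ'1, hn', -, -, -⟩ := h' F θ hP g₀ os
  exact shellWeightBound_crGap2₁₃VAt K₀ jcut ρ ρ' n₁ n₂ θ hP g₀ os E hsel hζm hρ0 hρ1 hρ'0 hρ'1 hεA hεB hδA hδB (summable_inv_add_inv hn hn')

end Summit.QuantumFields.YangMills.Theorems.N21GappedPairReadingShellFaceOfCloseness
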